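import Mathlib.LinearAlgebra.Isomorphisms
import Mathlib.LinearAlgebra.Finsupp.LinearCombination
import Literature.NumberTheory.Automorphic.RestrictedTensorProduct
import HarnessLib

/-!
# Restricted tensor products: universal property, uniqueness, independence of the base vectors
(proofs)

Topic `NumberTheory/Automorphic`; proof file for
`Literature/NumberTheory/Automorphic/RestrictedTensorProduct.lean` (namespace `Literature.Automorphic`),
discharging sorry-free the two named facts stated there over an arbitrary commutative ring `k`:

* `Literature.NumberTheory.Automorphic.IsRestrictedTensorProductRep.unique` — two restricted tensor products
  `(W, π, j)`, `(W', π', j')` of the same family `(ρ i, V i)` with the same base vectors `x₀` are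
  isomorphic by a *unique* linear isomorphism `e` with `e ∘ j = j'`, and `e` is equivariant
  (`IsRestrictedTensorProductRep.unique_holds`);
* `Literature.NumberTheory.Automorphic.IsRestrictedTensorProductRep.indep_of_base_vectors` — if `x₀' i = c i • x₀ i`
  with units `c i` for almost all `i`, restricted tensor products with respect to `x₀` and to
  `x₀'` are isomorphic representations of `Πʳ i, [G i, K i]`
  (`IsRestrictedTensorProductRep.indep_of_base_vectors_holds`).

Sources. Flath, *Decomposition of representations into tensor products* (Corvallis 1979), §2:
the restricted tensor product as the direct limit `lim_S ⨂_{i ∈ S} V i` along the maps inserting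
the base vectors, Example 2 (representations of restricted product groups) and the Remark
following it (dependence on the base vectors only up to scalars). Bump, *Automorphic forms and
representations* (1997), §3.3, pp. 293–294 (the same direct-limit definition; "changing a finite
number of the vectors `x_v°` does not change the restricted tensor product space",
Exercise 3.3.5, p. 300).

## The proofs

The characterising predicate `IsRestrictedTensorProduct k j S₀` of the statement file says:
`j` is restricted-multilinear, the induced maps `L_S : ⨂[k] i : S, V i → W` are injective for
all finite `S ⊇ S₀`, and `⨆_S range L_S = ⊤`.

1. **Universal property** (`IsRestrictedTensorProduct.exists_linearMap_apply_eq`,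
   `IsRestrictedTensorProduct.linearMap_ext`): for every restricted-multilinear
   `j' : RestrictedFamily V x₀ → W'` there is a unique linear `F : W → W'` with `F (j x) = j' x`.
   Uniqueness: the `j x` span `W` (each `range L_S` is spanned by values of `j`). Existence:
   `ψ = Σ aₓ • j x : (RestrictedFamily V x₀ →₀ k) → W` is surjective, and `ker ψ ≤ ker ψ'`
   (`ψ'` the same with `j'`): for a finitely supported `f` choose one finite `S ⊇ S₀` off which
   every `x` in the support of `f` is the base family; then `ψ f = L_S t` and `ψ' f = L'_S t` for
   the *same* `t = Σ f x • ⊗_{i ∈ S} x i`, so `ψ f = 0` forces `t = 0` (injectivity of `L_S`) and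
   `ψ' f = 0`. Hence `ψ'` factors through `W = (… →₀ k) / ker ψ`.
2. **Uniqueness** (`unique_holds`): the universal property both ways gives `F`, `F'` with
   `F' ∘ F ∘ j = j`, `F ∘ F' ∘ j' = j'`, hence inverse isomorphisms; equivariance of `F` is checked
   on the spanning set `j x` using the equivariance of `j` and `j'`.
3. **Independence of the base vectors** (`indep_of_base_vectors_holds`): with units `c i` such
   that `x₀' i = c i • x₀ i` off a finite set `T`, the coordinatewise rescaling
   `Φ : x ↦ (c i • x i)_i` (`RestrictedFamily.exists_rescale`) maps restricted families for `x₀`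
   equivariantly to restricted families for `x₀'` (this is the isomorphism of direct systems
   `⨂_{i∈S} V i → ⨂_{i∈S} V i`, `t ↦ (∏_{i ∈ S} c i) t`, of the printed proof). If `(W', π', j'')`
   is a restricted tensor product for `x₀'` then `(W', π', j'' ∘ Φ)` is one for `x₀` with
   exceptional set `S₀' ∪ T`: its finite-level maps are `(∏_{i∈S} c i) • L''_S` for `S ⊇ T`
   (`liftFinset_comp_rescale`), so injectivity and exhaustion transfer. Now apply uniqueness.
   The file contains theorems only (no new definitions): the rescaling map enters through the
   hypothesis `hΦ : ∀ x i, Φ x i = c i • x i`.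

## References

* D. Flath, *Decomposition of representations into tensor products*, Proc. Sympos. Pure Math.
  33 (Corvallis 1979), part 1, 179–183, §2. [Flath1979]
* D. Bump, *Automorphic forms and representations*, Cambridge 1997, §3.3 pp. 293–294 and
  Exercise 3.3.5. [Bump1997]
-/

open scoped RestrictedProduct TensorProduct
open Filter PiTensorProduct

namespace Literature.NumberTheory.Automorphic

universe u uk uG v w w' w''

/-! ### More API for restricted families -/

namespace RestrictedFamily

section Family

variable {ι : Type u} {V : ι → Type v} {x₀ : ∀ i, V i} [DecidableEq ι]

/-- A restricted family which is the base family off a finset `S` is the extension (by base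
vectors) of its restriction to `S`. [folklore] -/
lemma extend_restrict (S : Finset ι) (x : RestrictedFamily V x₀) (hx : ∀ i ∉ S, x i = x₀ i) :
    extend S (fun i : S => x i) = x := by
  ext i
  by_cases hi : i ∈ S
  · rw [extend_apply_of_mem _ _ hi]
  · rw [extend_apply_of_notMem _ _ hi, hx i hi]

/-- Finitely many restricted families are simultaneously equal to the base family off one finite
set of indices, which may be taken to contain any given finset `S₁`. [folklore] -/
lemma exists_finset_forall_apply_eq (S₁ : Finset ι) (s : Finset (RestrictedFamily V x₀)) :
    ∃ S : Finset ι, S₁ ⊆ S ∧ ∀ x ∈ s, ∀ i ∉ S, x i = x₀ i := by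
  refine ⟨S₁ ∪ s.biUnion fun x => (Filter.eventually_cofinite.1 x.eventually_eq).toFinset,
    Finset.subset_union_left, fun x hx i hi => ?_⟩
  by_contra hne
  exact hi (Finset.mem_union_right _ (Finset.mem_biUnion.2 ⟨x, hx, by simpa using hne⟩))

end Family

section Scale

variable {ι : Type u} {k : Type uk} [CommRing k] {V : ι → Type v} [∀ i, AddCommGroup (V i)]
  [∀ i, Module k (V i)] {x₀ x₀' : ∀ i, V i}

/-- **Rescaling of restricted families.** If `x₀' i = c i • x₀ i` for almost all `i`, with
units `c i ∈ kˣ`, there is a map `Φ` from restricted families with respect to `x₀` to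
restricted families with respect to `x₀'` given by `(Φ x) i = c i • x i`. On the finite tensor
products `⨂_{i ∈ S} V i` it induces multiplication by `∏_{i ∈ S} c i`, the isomorphism of direct
systems showing that the restricted tensor product depends on the base vectors only up to units
(Flath 1979, §2, Remark following Example 2). All later statements are about an arbitrary `Φ`
with this coordinate description (hypothesis `hΦ`).
[cite: Flath1979, §2  Remark following Example 2] -/
lemma exists_rescale (c : ι → kˣ) (hc : ∀ᶠ i in cofinite, x₀' i = c i • x₀ i) :
    ∃ Φ : RestrictedFamily V x₀ → RestrictedFamily V x₀', ∀ x i, Φ x i = c i • x i :=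
  ⟨fun x => RestrictedProduct.mk (fun i => c i • x i) <|
    (hc.and x.eventually_eq).mono fun i hi => by rw [Set.mem_singleton_iff, hi.2, hi.1],
    fun _ _ => rfl⟩

variable [DecidableEq ι] {c : ι → kˣ} {Φ : RestrictedFamily V x₀ → RestrictedFamily V x₀'}

/-- A rescaling map commutes with updating one coordinate (up to the unit in that coordinate).
[folklore] -/
lemma rescale_update (hΦ : ∀ x i, Φ x i = c i • x i) (x : RestrictedFamily V x₀) (i : ι)
    (v : V i) : Φ (x.update i v) = (Φ x).update i (c i • v) := by
  ext j
  simp only [hΦ, update_apply]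
  by_cases hj : j = i
  · subst hj
    simp
  · simp [Function.update_of_ne hj, hΦ]

/-- On a finset `S` off which `x₀' = c • x₀`, rescaling the extension by `x₀` of a finite family
`m` gives the extension by `x₀'` of the rescaled family. [folklore] -/
lemma rescale_extend (hΦ : ∀ x i, Φ x i = c i • x i) (S : Finset ι)
    (hS : ∀ i ∉ S, x₀' i = c i • x₀ i) (m : ∀ i : S, V i) :
    Φ (extend (x₀ := x₀) S m) = extend (x₀ := x₀') S (fun i => c i • m i) := by
  ext i
  by_cases hi : i ∈ S
  · simp [hΦ, hi]
  · simp [hΦ, hi, hS i hi]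

end Scale

end RestrictedFamily

/-! ### The universal property of the characterising predicate -/

section Multilinear

variable {ι : Type u} {k : Type uk} [CommRing k] {V : ι → Type v} [∀ i, AddCommGroup (V i)]
  [∀ i, Module k (V i)] {x₀ : ∀ i, V i} {W : Type w} [AddCommGroup W] [Module k W]
  {W' : Type w'} [AddCommGroup W'] [Module k W'] [DecidableEq ι]
  {j : RestrictedFamily V x₀ → W} {j' : RestrictedFamily V x₀ → W'}

namespace IsRestrictedMultilinear

/-- `liftFinset S` recovers `j x` from the restriction of `x` to any finset `S` off which `x` is
the base family. [folklore] -/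
lemma liftFinset_tprod_restrict (hj : IsRestrictedMultilinear k j) (S : Finset ι)
    (x : RestrictedFamily V x₀) (hx : ∀ i ∉ S, x i = x₀ i) :
    hj.liftFinset S (tprod k fun i : S => x i) = j x := by
  rw [liftFinset_tprod, RestrictedFamily.extend_restrict S x hx]

/-- The range of `liftFinset S` is spanned by the values `j (extend S m)`. [folklore] -/
lemma range_liftFinset (hj : IsRestrictedMultilinear k j) (S : Finset ι) :
    LinearMap.range (hj.liftFinset S) =
      Submodule.span k (Set.range fun m : (∀ i : S, V i) => j (RestrictedFamily.extend S m)) := by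
  rw [LinearMap.range_eq_map, ← PiTensorProduct.span_tprod_eq_top, Submodule.map_span,
    ← Set.range_comp]
  simp_rw [Function.comp_def, liftFinset_tprod]

/-- `j x` lies in the range of `liftFinset S` whenever `x` is the base family off `S`. [folklore] -/
lemma apply_mem_range_liftFinset (hj : IsRestrictedMultilinear k j) (S : Finset ι)
    (x : RestrictedFamily V x₀) (hx : ∀ i ∉ S, x i = x₀ i) :
    j x ∈ LinearMap.range (hj.liftFinset S) :=
  ⟨_, hj.liftFinset_tprod_restrict S x hx⟩

/-- The ranges of the maps `liftFinset S` increase with `S` (the direct system is directed).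
[folklore] -/
lemma range_liftFinset_mono (hj : IsRestrictedMultilinear k j) {S T : Finset ι} (hST : S ⊆ T) :
    LinearMap.range (hj.liftFinset S) ≤ LinearMap.range (hj.liftFinset T) := by
  rw [hj.range_liftFinset S, Submodule.span_le]
  rintro _ ⟨m, rfl⟩
  exact hj.apply_mem_range_liftFinset T _ fun i hi =>
    RestrictedFamily.extend_apply_of_notMem _ _ fun h => hi (hST h)

/-- Every `range (liftFinset S)` lies in the span of the values of `j`. [folklore] -/
lemma range_liftFinset_le_span (hj : IsRestrictedMultilinear k j) (S : Finset ι) :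
    LinearMap.range (hj.liftFinset S) ≤ Submodule.span k (Set.range j) := by
  rw [hj.range_liftFinset S]
  exact Submodule.span_mono (by rintro _ ⟨m, rfl⟩; exact ⟨_, rfl⟩)

/-- The computation behind the universal property: for a finitely supported
`f : RestrictedFamily V x₀ →₀ k` and a finset `S` off which every family in the support of `f`
is the base family, `liftFinset S (Σₓ f x • ⊗_{i ∈ S} x i) = Σₓ f x • j x`. [folklore] -/
lemma liftFinset_sum_smul_tprod (hj : IsRestrictedMultilinear k j) (S : Finset ι)
    (f : RestrictedFamily V x₀ →₀ k) (hf : ∀ x ∈ f.support, ∀ i ∉ S, x i = x₀ i) :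
    hj.liftFinset S (f.sum fun x a => a • tprod k fun i : S => x i) =
      Finsupp.linearCombination k j f := by
  rw [Finsupp.linearCombination_apply, Finsupp.sum, Finsupp.sum, map_sum]
  refine Finset.sum_congr rfl fun x hx => ?_
  rw [map_smul, hj.liftFinset_tprod_restrict S x (hf x hx)]

end IsRestrictedMultilinear

namespace IsRestrictedTensorProduct

variable {S₀ : Finset ι}

/-- In a restricted tensor product `(W, j)` the values `j x` span `W`. [folklore] -/
lemma span_range_eq_top (h : IsRestrictedTensorProduct k j S₀) :
    Submodule.span k (Set.range j) = ⊤ :=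
  top_unique <| h.iSup_range_liftFinset.symm.le.trans <|
    iSup_le fun S => h.isRestrictedMultilinear.range_liftFinset_le_span S

/-- Two linear maps out of a restricted tensor product which agree on the values `j x` are
equal (uniqueness half of the universal property). [folklore] -/
lemma linearMap_ext (h : IsRestrictedTensorProduct k j S₀) {M : Type w''} [AddCommGroup M]
    [Module k M] {F₁ F₂ : W →ₗ[k] M} (hF : ∀ x, F₁ (j x) = F₂ (j x)) : F₁ = F₂ :=
  LinearMap.ext_on_range h.span_range_eq_top hF

/-- Every element of a restricted tensor product comes from one finite level `S ⊇ S₁`, for any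
prescribed finite `S₁`. [folklore] -/
lemma exists_mem_range_liftFinset (h : IsRestrictedTensorProduct k j S₀) (S₁ : Finset ι)
    (w : W) :
    ∃ S : Finset ι, S₁ ⊆ S ∧ w ∈ LinearMap.range (h.isRestrictedMultilinear.liftFinset S) := by
  have hw : w ∈ Submodule.span k (Set.range j) := by rw [h.span_range_eq_top]; trivial
  induction hw using Submodule.span_induction with
  | mem _ hx =>
    obtain ⟨x, rfl⟩ := hx
    obtain ⟨S, hS₁, hS⟩ := RestrictedFamily.exists_finset_forall_apply_eq S₁ {x}
    exact ⟨S, hS₁, h.isRestrictedMultilinear.apply_mem_range_liftFinset S x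
      (hS x (Finset.mem_singleton_self x))⟩
  | zero => exact ⟨S₁, subset_rfl, zero_mem _⟩
  | add w₁ w₂ _ _ h₁ h₂ =>
    obtain ⟨T₁, hT₁, ht₁⟩ := h₁
    obtain ⟨T₂, hT₂, ht₂⟩ := h₂
    exact ⟨T₁ ∪ T₂, hT₁.trans Finset.subset_union_left, add_mem
      (h.isRestrictedMultilinear.range_liftFinset_mono Finset.subset_union_left ht₁)
      (h.isRestrictedMultilinear.range_liftFinset_mono Finset.subset_union_right ht₂)⟩
  | smul a w _ hw =>
    obtain ⟨T, hT, ht⟩ := hw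
    exact ⟨T, hT, Submodule.smul_mem _ a ht⟩

/-- **Universal property of the restricted tensor product** (existence half): every
restricted-multilinear map `j'` on the restricted families factors through `j` by a linear map
`F : W → W'`, `F (j x) = j' x`. This is the universal property of the direct limit
`lim_S ⨂_{i ∈ S} V i` (Flath 1979, §2; Bump 1997, §3.3): a linear relation `Σ aₓ j x = 0` only
involves finitely many `x`, all of which are the base family off one finite `S ⊇ S₀`, so it is
the image under the injective `liftFinset S` of the relation `Σ aₓ ⊗_{i∈S} x i = 0`, which `j'`
also respects. [cite: Flath1979, §2] -/
theorem exists_linearMap_apply_eq (h : IsRestrictedTensorProduct k j S₀)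
    (hj' : IsRestrictedMultilinear k j') : ∃ F : W →ₗ[k] W', ∀ x, F (j x) = j' x := by
  have hspan := h.span_range_eq_top
  obtain ⟨hj, hinj, -⟩ := h
  set ψ : (RestrictedFamily V x₀ →₀ k) →ₗ[k] W := Finsupp.linearCombination k j with hψdef
  have hψ : Function.Surjective ψ := by
    rw [← LinearMap.range_eq_top, hψdef, Finsupp.range_linearCombination]
    exact hspan
  have hker : LinearMap.ker ψ ≤ LinearMap.ker (Finsupp.linearCombination k j') := by
    intro f hf
    rw [LinearMap.mem_ker] at hf ⊢
    obtain ⟨S, hS₀, hS⟩ := RestrictedFamily.exists_finset_forall_apply_eq S₀ f.support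
    have ht : (f.sum fun x a => a • tprod k fun i : S => x i) = 0 :=
      hinj S hS₀ (by
        rw [hj.liftFinset_sum_smul_tprod S f hS, map_zero]
        exact hf)
    rw [← hj'.liftFinset_sum_smul_tprod S f hS, ht, map_zero]
  refine ⟨(LinearMap.ker ψ).liftQ _ hker ∘ₗ (ψ.quotKerEquivOfSurjective hψ).symm.toLinearMap,
    fun x => ?_⟩
  have hx : j x = ψ (Finsupp.single x 1) := by simp [hψdef]
  rw [hx, LinearMap.comp_apply, LinearEquiv.coe_toLinearMap,
    LinearMap.quotKerEquivOfSurjective_symm_apply, Submodule.liftQ_apply]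
  simp

end IsRestrictedTensorProduct

end Multilinear

/-! ### Rescaling the base vectors by units -/

section Scale

variable {ι : Type u} {k : Type uk} [CommRing k] {V : ι → Type v} [∀ i, AddCommGroup (V i)]
  [∀ i, Module k (V i)] {x₀ x₀' : ∀ i, V i} {W' : Type w'} [AddCommGroup W'] [Module k W']
  [DecidableEq ι] {j'' : RestrictedFamily V x₀' → W'} {c : ι → kˣ}
  {Φ : RestrictedFamily V x₀ → RestrictedFamily V x₀'}

namespace IsRestrictedMultilinear

/-- Precomposing a restricted-multilinear map for the base vectors `x₀'` with a rescaling map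
`Φ`, `(Φ x) i = c i • x i`, gives a restricted-multilinear map for the base vectors `x₀`.
[folklore] -/
lemma comp_rescale (hj'' : IsRestrictedMultilinear k j'') (hΦ : ∀ x i, Φ x i = c i • x i) :
    IsRestrictedMultilinear k (j'' ∘ Φ) where
  map_update_add x i v w := by
    simp only [Function.comp_apply, RestrictedFamily.rescale_update hΦ, smul_add,
      hj''.map_update_add]
  map_update_smul x i a v := by
    simp only [Function.comp_apply, RestrictedFamily.rescale_update hΦ]
    rw [smul_comm, hj''.map_update_smul]

/-- On a finite level `S` off which `x₀' = c • x₀`, the map induced by `j'' ∘ Φ` is the unit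
multiple `(∏_{i ∈ S} c i) • L''_S` of the map induced by `j''`: the isomorphism of direct
systems of the printed proof. (Flath 1979, §2.) [cite: Flath1979, §2  Remark following Example 2] -/
lemma liftFinset_comp_rescale (hj'' : IsRestrictedMultilinear k j'') (hΦ : ∀ x i, Φ x i = c i • x i)
    (S : Finset ι) (hS : ∀ i ∉ S, x₀' i = c i • x₀ i) :
    (hj''.comp_rescale hΦ).liftFinset S = ((∏ i : S, c i : kˣ) : k) • hj''.liftFinset S := by
  refine PiTensorProduct.ext ?_
  ext m
  simp only [LinearMap.compMultilinearMap_apply, LinearMap.smul_apply, liftFinset_tprod,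
    Function.comp_apply]
  rw [RestrictedFamily.rescale_extend hΦ S hS]
  simp_rw [Units.smul_def]
  rw [← liftFinset_tprod hj'', MultilinearMap.map_smul_univ, map_smul, liftFinset_tprod,
    Units.coe_prod]

/-- Injectivity at a finite level `S` off which `x₀' = c • x₀` transfers from `j''` to
`j'' ∘ Φ`. [folklore] -/
lemma injective_liftFinset_comp_rescale (hj'' : IsRestrictedMultilinear k j'')
    (hΦ : ∀ x i, Φ x i = c i • x i) (S : Finset ι) (hS : ∀ i ∉ S, x₀' i = c i • x₀ i)
    (hinj : Function.Injective (hj''.liftFinset S)) :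
    Function.Injective ((hj''.comp_rescale hΦ).liftFinset S) := by
  rw [hj''.liftFinset_comp_rescale hΦ S hS]
  intro a b hab
  simp only [LinearMap.smul_apply] at hab
  exact hinj (((∏ i : S, c i).isUnit.smul_left_cancel).1 hab)

/-- At a finite level `S` off which `x₀' = c • x₀`, the range of the map induced by `j''` is
contained in that of the map induced by `j'' ∘ Φ`. [folklore] -/
lemma range_liftFinset_le_comp_rescale (hj'' : IsRestrictedMultilinear k j'')
    (hΦ : ∀ x i, Φ x i = c i • x i) (S : Finset ι) (hS : ∀ i ∉ S, x₀' i = c i • x₀ i) :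
    LinearMap.range (hj''.liftFinset S) ≤
      LinearMap.range ((hj''.comp_rescale hΦ).liftFinset S) := by
  rw [hj''.liftFinset_comp_rescale hΦ S hS]
  rintro _ ⟨t, rfl⟩
  refine ⟨((∏ i : S, c i)⁻¹ : kˣ).val • t, ?_⟩
  rw [LinearMap.smul_apply, map_smul, smul_smul, Units.mul_inv, one_smul]

end IsRestrictedMultilinear

/-- **Transport of structure along a rescaling of the base vectors.** If `(W', j'')` is a
restricted tensor product of the `V i` with respect to `x₀'` (exceptional set `S₀'`) and
`x₀' i = c i • x₀ i` off a finset `T`, then for any rescaling map `Φ`, `(Φ x) i = c i • x i`,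
`(W', j'' ∘ Φ)` is a restricted tensor product with respect to `x₀`, with exceptional set
`S₀' ∪ T`. (Flath 1979, §2, Remark following Example 2; Bump 1997, Exercise 3.3.5.)
[cite: Flath1979, §2  Remark following Example 2] -/
theorem IsRestrictedTensorProduct.comp_rescale {S₀' : Finset ι}
    (h' : IsRestrictedTensorProduct k j'' S₀') (hΦ : ∀ x i, Φ x i = c i • x i) (T : Finset ι)
    (hT : ∀ i ∉ T, x₀' i = c i • x₀ i) : IsRestrictedTensorProduct k (j'' ∘ Φ) (S₀' ∪ T) := by
  obtain ⟨hj'', hinj, hsup⟩ := h'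
  have hT' : ∀ S : Finset ι, T ⊆ S → ∀ i ∉ S, x₀' i = c i • x₀ i := fun S hTS i hi =>
    hT i fun hi' => hi (hTS hi')
  refine ⟨hj''.comp_rescale hΦ, fun S hS => ?_, ?_⟩
  · exact hj''.injective_liftFinset_comp_rescale hΦ S (hT' S (Finset.union_subset_right hS))
      (hinj S (Finset.union_subset_left hS))
  · rw [eq_top_iff, ← hsup]
    refine iSup_le fun S => ?_
    calc LinearMap.range (hj''.liftFinset S)
        ≤ LinearMap.range (hj''.liftFinset (S ∪ T)) :=
          hj''.range_liftFinset_mono Finset.subset_union_left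
      _ ≤ LinearMap.range ((hj''.comp_rescale hΦ).liftFinset (S ∪ T)) :=
          hj''.range_liftFinset_le_comp_rescale hΦ _ (hT' _ Finset.subset_union_right)
      _ ≤ ⨆ S, LinearMap.range ((hj''.comp_rescale hΦ).liftFinset S) :=
          le_iSup (fun S => LinearMap.range ((hj''.comp_rescale hΦ).liftFinset S)) (S ∪ T)

end Scale

/-! ### The equivariant statements -/

section Rep

variable {ι : Type u} {k : Type uk} [CommRing k] {G : ι → Type uG} [∀ i, Group (G i)]
  {K : ∀ i, Subgroup (G i)} {V : ι → Type v} [∀ i, AddCommGroup (V i)] [∀ i, Module k (V i)]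
  {ρ : ∀ i, Representation k (G i) (V i)} {x₀ x₀' : ∀ i, V i} {c : ι → kˣ}
  {Φ : RestrictedFamily V x₀ → RestrictedFamily V x₀'}

/-- A rescaling map `Φ`, `(Φ x) i = c i • x i`, is equivariant for the coordinatewise actions of
`Πʳ i, [G i, K i]` (each `ρ i (g i)` is `k`-linear). [folklore] -/
lemma RestrictedFamily.rescale_smul (hΦ : ∀ x i, Φ x i = c i • x i)
    (hx₀ : ∀ᶠ i in cofinite, x₀ i ∈ (ρ i).fixedPoints (K i))
    (hx₀' : ∀ᶠ i in cofinite, x₀' i ∈ (ρ i).fixedPoints (K i))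
    (g : Πʳ i, [G i, K i]) (x : RestrictedFamily V x₀) :
    Φ (RestrictedFamily.smul ρ hx₀ g x) = RestrictedFamily.smul ρ hx₀' g (Φ x) := by
  ext i
  simp [hΦ, Units.smul_def]

variable [DecidableEq ι] {W : Type w} [AddCommGroup W] [Module k W] {W' : Type w'}
  [AddCommGroup W'] [Module k W'] {π : Representation k (Πʳ i, [G i, K i]) W}
  {π' : Representation k (Πʳ i, [G i, K i]) W'}
  {hx₀ : ∀ᶠ i in cofinite, x₀ i ∈ (ρ i).fixedPoints (K i)}
  {hx₀' : ∀ᶠ i in cofinite, x₀' i ∈ (ρ i).fixedPoints (K i)}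
  {j : RestrictedFamily V x₀ → W} {j' : RestrictedFamily V x₀ → W'}
  {j'' : RestrictedFamily V x₀' → W'} {S₀ S₀' : Finset ι}

/-- **Transport of structure along a rescaling of the base vectors** (equivariant version): if
`(W', π', j'')` is a restricted tensor product of the `ρ i` with respect to `x₀'`,
`x₀' i = c i • x₀ i` off a finset `T`, and `Φ` is a rescaling map, `(Φ x) i = c i • x i`, then
`(W', π', j'' ∘ Φ)` is a restricted tensor product of the `ρ i` with respect to `x₀`
(exceptional set `S₀' ∪ T`). (Flath 1979, §2, Remark following Example 2.)
[cite: Flath1979, §2  Remark following Example 2] -/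
theorem IsRestrictedTensorProductRep.comp_rescale
    (h' : IsRestrictedTensorProductRep ρ π' hx₀' j'' S₀') (hΦ : ∀ x i, Φ x i = c i • x i)
    (T : Finset ι) (hT : ∀ i ∉ T, x₀' i = c i • x₀ i)
    (hx₀ : ∀ᶠ i in cofinite, x₀ i ∈ (ρ i).fixedPoints (K i)) :
    IsRestrictedTensorProductRep ρ π' hx₀ (j'' ∘ Φ) (S₀' ∪ T) :=
  ⟨h'.1.comp_rescale hΦ T hT, fun g x => by
    simp only [Function.comp_apply, RestrictedFamily.rescale_smul hΦ hx₀ hx₀', h'.2]⟩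

/-- **Uniqueness of the restricted tensor product** (discharge of
`IsRestrictedTensorProductRep.unique`): two restricted tensor products `(W, π, j)`, `(W', π', j')`
of the same family with the same base vectors, over any commutative ring, are isomorphic by a
unique linear isomorphism `e` with `e ∘ j = j'`, and `e` is equivariant. Existence and
uniqueness of `e` are the universal property of the direct limit
(`IsRestrictedTensorProduct.exists_linearMap_apply_eq`, `.linearMap_ext`); equivariance is
checked on the spanning vectors `j x`. (Flath 1979, §2; Bump 1997, §3.3.) [cite: Flath1979, §2] -/
theorem IsRestrictedTensorProductRep.unique_holds :
    IsRestrictedTensorProductRep.unique (ρ := ρ) (π := π) (π' := π') (hx₀ := hx₀) (j := j)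
      (j' := j') (S₀ := S₀) (S₀' := S₀') := by
  intro h h'
  obtain ⟨F, hF⟩ := h.1.exists_linearMap_apply_eq h'.1.isRestrictedMultilinear
  obtain ⟨F', hF'⟩ := h'.1.exists_linearMap_apply_eq h.1.isRestrictedMultilinear
  have h₁ : F'.comp F = LinearMap.id := h.1.linearMap_ext fun x => by simp [hF, hF']
  have h₂ : F.comp F' = LinearMap.id := h'.1.linearMap_ext fun x => by simp [hF, hF']
  refine ⟨LinearEquiv.ofLinear F F' h₂ h₁, ⟨hF, fun g => ?_⟩, ?_⟩
  · refine h.1.linearMap_ext fun x => ?_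
    simp only [LinearMap.comp_apply, LinearEquiv.coe_coe, LinearEquiv.ofLinear_apply]
    rw [← h.map_smul, hF, hF, h'.map_smul]
  · rintro e ⟨he, -⟩
    refine LinearEquiv.toLinearMap_injective (h.1.linearMap_ext fun x => ?_)
    simp [he, hF]

/-- **Independence of the base vectors** (discharge of
`IsRestrictedTensorProductRep.indep_of_base_vectors`): if `x₀' i` is a unit multiple `c i • x₀ i`
of `x₀ i` for almost all `i`, then restricted tensor products `(W, π, j)` with respect to `x₀`
and `(W', π', j'')` with respect to `x₀'` are isomorphic representations of `Πʳ i, [G i, K i]`,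
over any commutative ring. Proof: choose units `c i` with `x₀' i = c i • x₀ i` off a finset
`T` and a rescaling map `Φ` (`RestrictedFamily.exists_rescale`); then `(W', π', j'' ∘ Φ)` is a
restricted tensor product with respect to `x₀` (`IsRestrictedTensorProductRep.comp_rescale`), so
uniqueness (`unique_holds`) applies. (Flath 1979, §2, Remark following Example 2; Bump 1997,
§3.3, p. 294 and Exercise 3.3.5.) [cite: Flath1979, §2  Remark following Example 2] -/
theorem IsRestrictedTensorProductRep.indep_of_base_vectors_holds :
    IsRestrictedTensorProductRep.indep_of_base_vectors (ρ := ρ) (π := π) (π' := π') (hx₀ := hx₀)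
      (j := j) (W' := W') (S₀ := S₀) (S₀' := S₀') := by
  intro x₀' hx₀' j'' hc h h'
  classical
  let c : ι → kˣ := fun i => if hi : ∃ c : kˣ, x₀' i = c • x₀ i then hi.choose else 1
  have hc' : ∀ᶠ i in cofinite, x₀' i = c i • x₀ i := hc.mono fun i hi => by
    simp only [c, dif_pos hi]
    exact hi.choose_spec
  have hT : ∀ i ∉ (Filter.eventually_cofinite.1 hc').toFinset, x₀' i = c i • x₀ i := fun i hi => by
    by_contra hne
    exact hi (by simpa using hne)
  obtain ⟨Φ, hΦ⟩ := RestrictedFamily.exists_rescale (V := V) c hc'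
  obtain ⟨e, ⟨-, he⟩, -⟩ :=
    IsRestrictedTensorProductRep.unique_holds h (h'.comp_rescale hΦ _ hT hx₀)
  exact ⟨e, he⟩

end Rep

end Literature.NumberTheory.Automorphic
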